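import Summits.CriticalPhenomena.Ising3D.Control2DConvergenceRate
import Mathlib.Analysis.Normed.Group.Tannery
import Mathlib.Analysis.SpecialFunctions.Pow.Continuity
import Mathlib.Tactic.Linarith
import Mathlib.Tactic.Positivity
import Mathlib.Tactic.FieldSimp
import Mathlib.Tactic.Ring
import HarnessLib

/-!
# The two corners of the diagonal, exactly: the `s`-channel identity at `x → 0⁺` and the crossed-channel identity at
# `x → 1⁻` each dominate with an explicit constant — for every unitary typed solution
(cell `pub-ising3x`, seat controls-1 gen 44; PAPER §6.2 / Appendix E — CONTROL-ONLY; sequel to `Control2DConvergenceRate`)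

HONEST FRAMING: lottery ticket; floor = tightest certified 3D Ising CFT bounds; no exact-solution
claim without a proof. CONTROL-ONLY (`d = 2`, global `sl(2) × sl(2)` blocks, `Δ_σ = s` an INPUT, axiom set
`A2D′`); nothing here is about `d = 3`, no certificate, functional or number of the record is touched, and no
new hypothesis or named fact enters.

WHAT THIS FILE ADDS: the leading power law AND coefficient of `G - 1` at each corner of the real diagonal, for the typed class.
`Control2DConvergenceRate` bounded the diagonal four-point function `G(x,x) = 1 + Σ p_i g_i(x,x)` of every unitary solution of the typed
sum rule at `Δ_σ = s > 0` two-sidedly near the corner `x → 1`: `(x/(1-x))^{2s} ≤ G(x,x) ≤ (x/(1-x))^{2s} G(½,½)`. Here both corners are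
computed EXACTLY, by Tannery's theorem (dominated convergence for series, Mathlib `tendsto_tsum_of_dominated_convergence`) with the
dominating family `2^E p_i g_i(½,½)` that the scaling lemma `globalBlock_diag_le_rpow_mul` provides on `x ≤ ½`. The dimension-zero
weight `P₀ := Σ'_{Δ_i = 0} p_i` appears explicitly in both limits; for every class of the record (and under any scalar gap) it is `0`, so
the corner constant is exactly `1` there; `Control2DZeroDimension` (E.1q) is the `s = 0` counterpart, where ONLY that weight survives.

* `chiralBlock_le_rpow_mul_origin`, `tendsto_chiralBlock_div_rpow` — `1 ≤ k_{2h}(x)/x^h ≤ 1 + (x/b)(k_{2h}(b)/b^h - 1)` for `0 < x ≤ b < 1`,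
  hence `k_{2h}(x)/x^h → 1` as `x → 0⁺`; `tendsto_globalBlock_diag_div_rpow` — `g_{Δ,ℓ}(x,x)/x^Δ → 2`.
* **`CrossingData.tendsto_fourPoint_sub_one_div_rpow (hU) (hconv) (hE : ∀ i, E ≤ Δ_i)`** — `(G(x,x) - 1)/x^E → 2·Σ'_{Δ_i = E} p_i` as
  `x → 0⁺`: the leading exponent and the leading coefficient of `G - 1` at the origin are the lowest exchanged dimension and twice its
  total weight (the limit is `0` when no label sits at `E`); `tendsto_fourPoint_origin` — `G(x,x) → 1 + 2·Σ'_{Δ_i = 0} p_i`.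
* **`CrossingData.tendsto_fourPoint_corner (hU) (hC) (hs : 0 < s)`** — `((1-x)²)^s · G(x,x) → 1 + 2·Σ'_{Δ_i = 0} p_i` as `x → 1⁻`
  (crossing `fourPoint_crossing_free` turns the corner `x → 1` into the origin of the crossed channel); for data with no weight at
  dimension `0` — every class of the record, any scalar gap — **`tendsto_fourPoint_corner_of_pos`: `((1-x)²)^s G(x,x) → 1`**, i.e.
  `G(x,x) ∼ (1-x)^{-2Δ_σ}` with constant exactly `1`. This is the HYPOTHESIS (input) of the Hardy–Littlewood Tauberian step of
  Pappadopulo–Rychkov–Espin–Rattazzi 2012 §4.2 — their eq. (4.7) «`ℒ(β) ∼ β^{-2Δ_φ}` (`β → 0`)», read with `β = -log x` on the real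
  diagonal — established for the typed two-dimensional class; the CONCLUSION of that step (`F(E) ∼ E^{2Δ_φ}/Γ(2Δ_φ+1)`) stays NOT
  claimed. `record_fourPoint_corners (w)` at `Δ_σ = 1/8` (both corners are the bare identity there).

NOT claimed: the Tauberian CONCLUSION `F(E) ∼ E^{2s}/Γ(2s+1)` of PRER §4.2 (a Hardy–Littlewood/Karamata theorem; not in Mathlib and
not proved here — `Control2DConvergenceRate` holds the elementary `O(E^{2s})` bound); rates of approach to either limit; anything off the
REAL diagonal / square; twists; Virasoro; anything three-dimensional; any new bound; no number of the record touched.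

References: D. Pappadopulo, S. Rychkov, J. Espin, R. Rattazzi, Phys. Rev. D 86 (2012) 105043, §4.2 eq. (4.7)
[cite: PappadopuloRychkovEspinRattazzi2012PRD, §4.2]; R. Rattazzi, V. S. Rychkov, E. Tonni, A. Vichi, JHEP 12 (2008) 031, §3
[cite: RattazziEtAl2008, §3]; F. A. Dolan, H. Osborn, Nucl. Phys. B 678 (2004) 491, §3 [cite: DolanOsborn2004, §3]. Tree:
`hasSum_chiralBlock`, `chiralCoeff_nonneg` (`Control2DTermwise`); `chiralCoeff_zero_right`, `rpow_le_chiralBlock` (`Control2DChiralEnvelope`);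
`globalBlock_diag_le_rpow_mul` (`Control2DConvergenceRate`); `globalBlock_nonneg`, `fourPoint` (`Control2DFourPoint`); `opeConvergent_free`,
`fourPoint_crossing_free` (`Control2DOpeConvergenceFree`); `lowerBound_of_location`, `twoSided_2d_kernel099` (the record). Mathlib:
`tendsto_tsum_of_dominated_convergence`, `tendsto_of_tendsto_of_tendsto_of_le_of_le'`, `Ioo_mem_nhdsGT`, `tsum_subtype`.
-/

namespace Summit.CriticalPhenomena.Ising3D.Control2D

open Set Filter Topology
open Literature.MathematicalPhysics.QuantumFieldTheory.ConformalBootstrap3D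

/-! ### The chiral block at the origin -/

/-- **Two-sided control of `k_{2h}(x)/x^h` near `0`**: for `h ≥ 0` and `0 < x ≤ b < 1`,
`x^h ≤ k_{2h}(x) ≤ x^h · (1 + (x/b)(k_{2h}(b)/b^h - 1))` — termwise on the chiral series: the `m = 0` term is `x^h`, and for `m ≥ 1`
`x^{h+m} = x^h x^m ≤ x^h (x/b) b^m`. [folklore] -/
theorem chiralBlock_le_rpow_mul_origin {h x b : ℝ} (hh : 0 ≤ h) (hx : 0 < x) (hxb : x ≤ b) (hb : b < 1) :
    chiralBlock h x ≤ x ^ h * (1 + x / b * (chiralBlock h b / b ^ h - 1)) := by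
  have hb0 : 0 < b := lt_of_lt_of_le hx hxb
  have hbh : 0 < b ^ h := Real.rpow_pos_of_pos hb0 h
  have hθ : 0 ≤ x / b := (div_pos hx hb0).le
  have hθ1 : x / b ≤ 1 := (div_le_one hb0).mpr hxb
  have Sx := hasSum_chiralBlock h hx (lt_of_le_of_lt hxb hb)
  have Sb := hasSum_chiralBlock h hb0 hb
  -- the comparison family: `x^h · ((1 - x/b)·[m = 0] + (x/b) · a_m b^{h+m} / b^h)`
  have Sδ : HasSum (fun m : ℕ => if m = 0 then x ^ h * (1 - x / b) else 0) (x ^ h * (1 - x / b)) :=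
    hasSum_ite_eq 0 _
  have Sb' : HasSum (fun m : ℕ => x ^ h * (x / b) / b ^ h * (chiralCoeff h m * b ^ (h + (m : ℝ))))
      (x ^ h * (x / b) / b ^ h * chiralBlock h b) := Sb.mul_left _
  have S := Sδ.add Sb'
  have hval : x ^ h * (1 - x / b) + x ^ h * (x / b) / b ^ h * chiralBlock h b =
      x ^ h * (1 + x / b * (chiralBlock h b / b ^ h - 1)) := by
    field_simp
    ring
  rw [hval] at S
  refine hasSum_le (fun m => ?_) Sx S
  have ha : 0 ≤ chiralCoeff h m := chiralCoeff_nonneg hh m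
  rcases Nat.eq_zero_or_pos m with hm | hm
  · subst hm
    simp only [Nat.cast_zero, add_zero, if_true, chiralCoeff_zero_right, one_mul]
    have : x ^ h * (x / b) / b ^ h * b ^ h = x ^ h * (x / b) := by field_simp
    rw [this]
    linarith
  · have hm' : m ≠ 0 := Nat.pos_iff_ne_zero.mp hm
    simp only [hm', if_false, zero_add]
    -- `a_m x^{h+m} ≤ x^h (x/b) b^{-h} a_m b^{h+m}` ⇔ `x^m ≤ (x/b) b^m`
    have hxm : x ^ (m : ℝ) ≤ x / b * b ^ (m : ℝ) := by
      have hm1 : (1 : ℝ) ≤ m := by exact_mod_cast hm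
      have e1 : x ^ ((m : ℝ) - 1) = x ^ (m : ℝ) / x := Real.rpow_sub_one hx.ne' _
      have e2 : b ^ ((m : ℝ) - 1) = b ^ (m : ℝ) / b := Real.rpow_sub_one hb0.ne' _
      have hle : x ^ ((m : ℝ) - 1) ≤ b ^ ((m : ℝ) - 1) := Real.rpow_le_rpow hx.le hxb (by linarith)
      rw [e1, e2, div_le_div_iff₀ hx hb0] at hle
      rw [div_mul_eq_mul_div, le_div_iff₀ hb0]
      linarith
    have e3 : x ^ h * (x / b) / b ^ h * (chiralCoeff h m * b ^ (h + (m : ℝ))) =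
        chiralCoeff h m * (x ^ h * (x / b * b ^ (m : ℝ))) := by
      rw [Real.rpow_add hb0]; field_simp
    rw [e3, Real.rpow_add hx]
    exact mul_le_mul_of_nonneg_left (mul_le_mul_of_nonneg_left hxm (Real.rpow_nonneg hx.le h)) ha

/-- **`k_{2h}(x)/x^h → 1` as `x → 0⁺`** (`h ≥ 0`): squeeze between `1` (`rpow_le_chiralBlock`) and
`1 + 2x (2^h k_{2h}(½) - 1)` (`chiralBlock_le_rpow_mul_origin` with `b = ½`). [folklore] -/
theorem tendsto_chiralBlock_div_rpow {h : ℝ} (hh : 0 ≤ h) :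
    Tendsto (fun x : ℝ => chiralBlock h x / x ^ h) (𝓝[>] 0) (𝓝 1) := by
  set C : ℝ := chiralBlock h (1 / 2) / (1 / 2 : ℝ) ^ h - 1 with hC
  have hup : Tendsto (fun x : ℝ => 1 + x / (1 / 2) * C) (𝓝[>] 0) (𝓝 1) := by
    have h0 : Tendsto (fun x : ℝ => 1 + x / (1 / 2) * C) (𝓝 0) (𝓝 (1 + 0 / (1 / 2) * C)) :=
      ((continuous_const.add ((continuous_id.div_const _).mul continuous_const)).tendsto 0)
    rw [zero_div, zero_mul, add_zero] at h0
    exact h0.mono_left nhdsWithin_le_nhds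
  have hev : ∀ᶠ x in 𝓝[>] (0 : ℝ), x ∈ Ioo (0 : ℝ) (1 / 2) := Ioo_mem_nhdsGT (by norm_num)
  refine tendsto_of_tendsto_of_tendsto_of_le_of_le' tendsto_const_nhds hup ?_ ?_
  · filter_upwards [hev] with x hx
    have hxh : 0 < x ^ h := Real.rpow_pos_of_pos hx.1 h
    rw [le_div_iff₀ hxh, one_mul]
    exact rpow_le_chiralBlock hh hx.1 (by linarith [hx.2])
  · filter_upwards [hev] with x hx
    have hxh : 0 < x ^ h := Real.rpow_pos_of_pos hx.1 h
    rw [div_le_iff₀ hxh, mul_comm]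
    exact chiralBlock_le_rpow_mul_origin hh hx.1 hx.2.le (by norm_num)

/-- **`g_{Δ,ℓ}(x,x)/x^Δ → 2` as `x → 0⁺`** for a unitary label (`g(x,x) = 2 k_{2h}(x) k_{2h̄}(x)`, `h + h̄ = Δ`). [folklore] -/
theorem tendsto_globalBlock_diag_div_rpow {Δ : ℝ} {ℓ : ℕ} (hΔ : (ℓ : ℝ) ≤ Δ) :
    Tendsto (fun x : ℝ => globalBlock Δ ℓ x x / x ^ Δ) (𝓝[>] 0) (𝓝 2) := by
  have hℓ : (0 : ℝ) ≤ ℓ := Nat.cast_nonneg ℓ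
  have A := tendsto_chiralBlock_div_rpow (h := (Δ + ℓ) / 2) (by linarith)
  have B := tendsto_chiralBlock_div_rpow (h := (Δ - ℓ) / 2) (by linarith)
  have hprod := (A.mul B).const_mul 2
  rw [show (2 : ℝ) * (1 * 1) = 2 by norm_num] at hprod
  refine hprod.congr' ?_
  filter_upwards [self_mem_nhdsWithin] with x hx
  have hx0 : 0 < x := hx
  have hsplit : x ^ Δ = x ^ ((Δ + ℓ) / 2) * x ^ ((Δ - ℓ) / 2) := by
    rw [← Real.rpow_add hx0]; ring_nf
  rw [hsplit]
  unfold globalBlock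
  have h1 : 0 < x ^ ((Δ + ℓ) / 2) := Real.rpow_pos_of_pos hx0 _
  have h2 : 0 < x ^ ((Δ - ℓ) / 2) := Real.rpow_pos_of_pos hx0 _
  field_simp
  ring

namespace CrossingData

variable {D : CrossingData} {s : ℝ}

/-! ### The origin of the diagonal: the `s`-channel identity and the lowest exchanged dimension -/

/-- The dominating family for Tannery's theorem: for a unitary label with `Δ_i ≥ E` and `0 < x ≤ ½`,
`p_i g_i(x,x) / x^E ≤ 2^E · p_i g_i(½,½)` (scaling `g_i(x,x) ≤ (2x)^{Δ_i} g_i(½,½)` and `(2x)^{Δ_i} x^{-E} ≤ 2^E`). [folklore] -/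
theorem term_div_rpow_le (hU : D.IsUnitary) {E : ℝ} (i : D.ι) (hE : E ≤ D.Δ i) {x : ℝ} (hx0 : 0 < x) (hx2 : x ≤ 1 / 2) :
    D.p i * globalBlock (D.Δ i) (D.spin i) x x / x ^ E ≤ (2 : ℝ) ^ E * (D.p i * globalBlock (D.Δ i) (D.spin i) (1 / 2) (1 / 2)) := by
  have hhalf : (1 / 2 : ℝ) ∈ Ioo (0 : ℝ) 1 := ⟨by norm_num, by norm_num⟩
  have hg := globalBlock_diag_le_rpow_mul (hU i).2.1 hx0 hx2 (by norm_num : (1 / 2 : ℝ) < 1)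
  have hxE : 0 < x ^ E := Real.rpow_pos_of_pos hx0 E
  have hp0 : 0 ≤ D.p i := (hU i).2.2
  have hg0 : 0 ≤ globalBlock (D.Δ i) (D.spin i) (1 / 2) (1 / 2) := globalBlock_nonneg (hU i).2.1 hhalf hhalf
  -- `(x/(1/2))^{Δ_i} / x^E ≤ 2^E`
  have hθ : (x / (1 / 2)) ^ D.Δ i / x ^ E ≤ (2 : ℝ) ^ E := by
    rw [div_le_iff₀ hxE]
    have e1 : (x / (1 / 2)) ^ D.Δ i = (2 : ℝ) ^ D.Δ i * x ^ D.Δ i := by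
      rw [show x / (1 / 2) = 2 * x by ring, Real.mul_rpow (by norm_num) hx0.le]
    have e2 : (2 : ℝ) ^ E * x ^ E = (2 : ℝ) ^ D.Δ i * ((1 / 2 : ℝ) ^ (D.Δ i - E) * x ^ E) := by
      rw [one_div, Real.inv_rpow (by norm_num : (0 : ℝ) ≤ 2), Real.rpow_sub (by norm_num : (0 : ℝ) < 2)]
      field_simp
    rw [e1, e2]
    refine mul_le_mul_of_nonneg_left ?_ (Real.rpow_nonneg (by norm_num) _)
    have hx' : x ^ D.Δ i = x ^ (D.Δ i - E) * x ^ E := by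
      rw [← Real.rpow_add hx0]; ring_nf
    rw [hx']
    exact mul_le_mul_of_nonneg_right (Real.rpow_le_rpow hx0.le hx2 (by linarith)) hxE.le
  calc D.p i * globalBlock (D.Δ i) (D.spin i) x x / x ^ E
      ≤ D.p i * ((x / (1 / 2)) ^ D.Δ i * globalBlock (D.Δ i) (D.spin i) (1 / 2) (1 / 2)) / x ^ E := by
        exact div_le_div_of_nonneg_right (mul_le_mul_of_nonneg_left hg hp0) hxE.le
    _ = (x / (1 / 2)) ^ D.Δ i / x ^ E * (D.p i * globalBlock (D.Δ i) (D.spin i) (1 / 2) (1 / 2)) := by ring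
    _ ≤ (2 : ℝ) ^ E * (D.p i * globalBlock (D.Δ i) (D.spin i) (1 / 2) (1 / 2)) :=
        mul_le_mul_of_nonneg_right hθ (mul_nonneg hp0 hg0)

/-- **The leading term of `G - 1` at the origin.** For unitary data with convergent expansion all of whose labels have `Δ_i ≥ E`:
`(G(x,x) - 1)/x^E → Σ'_i [Δ_i = E] · 2 p_i` as `x → 0⁺` — Tannery's theorem with the dominating family of `term_div_rpow_le` (summable
by convergence at `(½,½)`) and the termwise limits `2 p_i` (`Δ_i = E`, `tendsto_globalBlock_diag_div_rpow`) and `0` (`Δ_i > E`: the extra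
factor `x^{Δ_i - E} → 0`). [cite: PappadopuloRychkovEspinRattazzi2012PRD, §4.2] -/
theorem tendsto_fourPoint_sub_one_div_rpow (hU : D.IsUnitary) (hconv : D.OpeConvergent) {E : ℝ} (hE : ∀ i, E ≤ D.Δ i) :
    Tendsto (fun x : ℝ => (D.fourPoint x x - 1) / x ^ E) (𝓝[>] 0)
      (𝓝 (∑' i, if D.Δ i = E then 2 * D.p i else 0)) := by
  have hhalf : (1 / 2 : ℝ) ∈ Ioo (0 : ℝ) 1 := ⟨by norm_num, by norm_num⟩
  have hbound := (hconv (1 / 2) (1 / 2) hhalf hhalf).mul_left ((2 : ℝ) ^ E)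
  have hev : ∀ᶠ x in 𝓝[>] (0 : ℝ), x ∈ Ioo (0 : ℝ) (1 / 2) := Ioo_mem_nhdsGT (by norm_num)
  have hT := tendsto_tsum_of_dominated_convergence (𝓕 := 𝓝[>] (0 : ℝ))
    (f := fun x i => D.p i * globalBlock (D.Δ i) (D.spin i) x x / x ^ E)
    (g := fun i => if D.Δ i = E then 2 * D.p i else 0) hbound ?_ ?_
  · refine hT.congr' ?_
    filter_upwards [hev] with x hx
    have hxI : x ∈ Ioo (0 : ℝ) 1 := ⟨hx.1, by linarith [hx.2]⟩
    have hS := hconv x x hxI hxI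
    show ∑' i, D.p i * globalBlock (D.Δ i) (D.spin i) x x / x ^ E = (D.fourPoint x x - 1) / x ^ E
    rw [show D.fourPoint x x - 1 = ∑' i, D.p i * globalBlock (D.Δ i) (D.spin i) x x by unfold fourPoint; ring]
    simp only [div_eq_mul_inv]
    rw [tsum_mul_right]
  · -- termwise limits
    intro i
    by_cases hi : D.Δ i = E
    · simp only [hi, if_true]
      have h := (tendsto_globalBlock_diag_div_rpow (hU i).2.1).const_mul (D.p i)
      rw [hi] at h
      rw [show 2 * D.p i = D.p i * 2 by ring]
      refine h.congr' ?_
      filter_upwards [self_mem_nhdsWithin] with x hx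
      ring
    · simp only [hi, if_false]
      have hlt : E < D.Δ i := lt_of_le_of_ne (hE i) (Ne.symm hi)
      -- `p_i (g_i/x^{Δ_i}) · x^{Δ_i - E} → p_i · 2 · 0`
      have h1 := (tendsto_globalBlock_diag_div_rpow (hU i).2.1).const_mul (D.p i)
      have h2 : Tendsto (fun x : ℝ => x ^ (D.Δ i - E)) (𝓝[>] 0) (𝓝 0) := by
        have hc : Tendsto (fun x : ℝ => x ^ (D.Δ i - E)) (𝓝 0) (𝓝 ((0 : ℝ) ^ (D.Δ i - E))) :=
          (Real.continuous_rpow_const (by linarith)).tendsto 0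
        rw [Real.zero_rpow (by linarith)] at hc
        exact hc.mono_left nhdsWithin_le_nhds
      have h3 := h1.mul h2
      rw [mul_zero] at h3
      refine h3.congr' ?_
      filter_upwards [self_mem_nhdsWithin] with x hx
      have hx0 : 0 < x := hx
      have hxΔ : 0 < x ^ D.Δ i := Real.rpow_pos_of_pos hx0 _
      have hsplit : x ^ E = x ^ D.Δ i / x ^ (D.Δ i - E) := by
        rw [eq_div_iff (Real.rpow_pos_of_pos hx0 _).ne', ← Real.rpow_add hx0]; ring_nf
      show D.p i * (globalBlock (D.Δ i) (D.spin i) x x / x ^ D.Δ i) * x ^ (D.Δ i - E) =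
        D.p i * globalBlock (D.Δ i) (D.spin i) x x / x ^ E
      rw [hsplit]
      field_simp
  · -- domination on `(0, ½)`
    filter_upwards [hev] with x hx
    intro i
    rw [Real.norm_eq_abs, abs_of_nonneg (div_nonneg (mul_nonneg (hU i).2.2
      (globalBlock_nonneg (hU i).2.1 ⟨hx.1, by linarith [hx.2]⟩ ⟨hx.1, by linarith [hx.2]⟩)) (Real.rpow_nonneg hx.1.le E))]
    exact term_div_rpow_le hU i (hE i) hx.1 hx.2.le

/-- The same limit written over the labels AT `E`: `Σ'_i [Δ_i = E] 2 p_i = 2 · Σ'_{i : Δ_i = E} p_i`. [folklore] -/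
theorem tsum_ite_dim_eq (D : CrossingData) (E : ℝ) :
    (∑' i, if D.Δ i = E then 2 * D.p i else 0) = 2 * ∑' i : ↥({i : D.ι | D.Δ i = E} : Set D.ι), D.p i := by
  rw [tsum_subtype ({i : D.ι | D.Δ i = E} : Set D.ι) D.p, ← tsum_mul_left]
  refine tsum_congr fun i => ?_
  by_cases hi : D.Δ i = E
  · have hmem : i ∈ ({i : D.ι | D.Δ i = E} : Set D.ι) := hi
    rw [if_pos hi, Set.indicator_of_mem hmem]
  · have hmem : i ∉ ({i : D.ι | D.Δ i = E} : Set D.ι) := hi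
    rw [if_neg hi, Set.indicator_of_notMem hmem, mul_zero]

/-- **`G` at the origin of the diagonal**: `G(x,x) → 1 + 2·Σ'_{Δ_i = 0} p_i` as `x → 0⁺` (unitary data, convergent expansion; under
unitarity every label has `Δ_i ≥ 0`, and only dimension-zero scalars survive the limit). [folklore] -/
theorem tendsto_fourPoint_origin (hU : D.IsUnitary) (hconv : D.OpeConvergent) :
    Tendsto (fun x : ℝ => D.fourPoint x x) (𝓝[>] 0)
      (𝓝 (1 + 2 * ∑' i : ↥({i : D.ι | D.Δ i = 0} : Set D.ι), D.p i)) := by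
  have hE : ∀ i, (0 : ℝ) ≤ D.Δ i := fun i => (Nat.cast_nonneg _).trans (hU i).2.1
  have h := tendsto_fourPoint_sub_one_div_rpow hU hconv hE
  rw [tsum_ite_dim_eq] at h
  have h' := h.const_add 1
  refine h'.congr' ?_
  filter_upwards [self_mem_nhdsWithin] with x hx
  show 1 + (D.fourPoint x x - 1) / x ^ (0 : ℝ) = D.fourPoint x x
  rw [Real.rpow_zero, div_one]; ring

/-! ### The far corner: the crossed-channel identity -/

/-- **`G` at the far corner of the diagonal.** For every unitary solution of the typed sum rule at `Δ_σ = s > 0`: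
`((1-x)²)^s · G(x,x) → 1 + 2·Σ'_{Δ_i = 0} p_i` as `x → 1⁻` — crossing symmetry `((1-x)²)^s G(x,x) = (x²)^s G(1-x,1-x)`
(`fourPoint_crossing_free`) and `tendsto_fourPoint_origin` along `x ↦ 1 - x`. [cite: PappadopuloRychkovEspinRattazzi2012PRD, §4.2] -/
theorem tendsto_fourPoint_corner (hU : D.IsUnitary) (hC : D.SatisfiesCrossing s) (hs : 0 < s) :
    Tendsto (fun x : ℝ => ((1 - x) * (1 - x)) ^ s * D.fourPoint x x) (𝓝[<] 1)
      (𝓝 (1 + 2 * ∑' i : ↥({i : D.ι | D.Δ i = 0} : Set D.ι), D.p i)) := by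
  set L : ℝ := 1 + 2 * ∑' i : ↥({i : D.ι | D.Δ i = 0} : Set D.ι), D.p i with hL
  have hconv := opeConvergent_free hU hC hs
  -- `x ↦ 1 - x` maps `𝓝[<] 1` into `𝓝[>] 0`
  have hφ : Tendsto (fun x : ℝ => 1 - x) (𝓝[<] 1) (𝓝[>] 0) := by
    refine tendsto_nhdsWithin_of_tendsto_nhds_of_eventually_within _ ?_ ?_
    · have : Tendsto (fun x : ℝ => 1 - x) (𝓝 1) (𝓝 (1 - 1)) := (continuous_const.sub continuous_id).tendsto 1
      rw [sub_self] at this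
      exact this.mono_left nhdsWithin_le_nhds
    · filter_upwards [self_mem_nhdsWithin] with x hx
      exact sub_pos.mpr (show x < 1 from hx)
  have hG : Tendsto (fun x : ℝ => D.fourPoint (1 - x) (1 - x)) (𝓝[<] 1) (𝓝 L) :=
    (tendsto_fourPoint_origin hU hconv).comp hφ
  have hu : Tendsto (fun x : ℝ => (x * x) ^ s) (𝓝[<] 1) (𝓝 1) := by
    have hc : Tendsto (fun x : ℝ => (x * x) ^ s) (𝓝 1) (𝓝 (((1 : ℝ) * 1) ^ s)) :=
      ((Real.continuous_rpow_const hs.le).comp (continuous_id.mul continuous_id)).tendsto 1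
    rw [mul_one, Real.one_rpow] at hc
    exact hc.mono_left nhdsWithin_le_nhds
  have hprod := hu.mul hG
  rw [one_mul] at hprod
  refine hprod.congr' ?_
  have hev : ∀ᶠ x in 𝓝[<] (1 : ℝ), x ∈ Ioo (0 : ℝ) 1 := Ioo_mem_nhdsLT (by norm_num)
  filter_upwards [hev] with x hx
  exact (fourPoint_crossing_free hU hC hs hx hx).symm

/-- **Data with no weight at dimension zero: `((1-x)²)^s · G(x,x) → 1` as `x → 1⁻`**, i.e. `G(x,x) ∼ (1-x)^{-2Δ_σ}` with constant
exactly `1`, for every unitary solution of the typed sum rule at `s > 0` whose weighted labels all have positive dimension (any scalar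
gap; every class of the record, where `Σ'_{Δ_i = 0} p_i = 0`). This is the HYPOTHESIS (input) of the Hardy–Littlewood Tauberian step
of Pappadopulo–Rychkov–Espin–Rattazzi 2012 §4.2 (their eq. (4.7) «`ℒ(β) ∼ β^{-2Δ_φ}`»), for the typed class; the CONCLUSION of that
step stays NOT claimed. [cite: PappadopuloRychkovEspinRattazzi2012PRD, §4.2] -/
theorem tendsto_fourPoint_corner_of_pos (hU : D.IsUnitary) (hC : D.SatisfiesCrossing s) (hs : 0 < s)
    (hpos : ∀ i, D.p i ≠ 0 → 0 < D.Δ i) :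
    Tendsto (fun x : ℝ => ((1 - x) * (1 - x)) ^ s * D.fourPoint x x) (𝓝[<] 1) (𝓝 1) := by
  have h := tendsto_fourPoint_corner hU hC hs
  have hterm : ∀ i : ↥({i : D.ι | D.Δ i = 0} : Set D.ι), D.p i = 0 := fun i => by
    by_contra hp
    have h1 := hpos i hp
    have hi : D.Δ (i : D.ι) = 0 := i.2
    linarith
  have hzero : ∑' i : ↥({i : D.ι | D.Δ i = 0} : Set D.ι), D.p i = 0 := by
    rw [tsum_congr hterm, tsum_zero]
  rw [hzero, mul_zero, add_zero] at h
  exact h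

/-- The origin version for data with no weight at dimension zero: `G(x,x) → 1` as `x → 0⁺`. [folklore] -/
theorem tendsto_fourPoint_origin_of_pos (hU : D.IsUnitary) (hconv : D.OpeConvergent)
    (hpos : ∀ i, D.p i ≠ 0 → 0 < D.Δ i) :
    Tendsto (fun x : ℝ => D.fourPoint x x) (𝓝[>] 0) (𝓝 1) := by
  have h := tendsto_fourPoint_origin hU hconv
  have hterm : ∀ i : ↥({i : D.ι | D.Δ i = 0} : Set D.ι), D.p i = 0 := fun i => by
    by_contra hp
    have h1 := hpos i hp
    have hi : D.Δ (i : D.ι) = 0 := i.2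
    linarith
  have hzero : ∑' i : ↥({i : D.ι | D.Δ i = 0} : Set D.ι), D.p i = 0 := by
    rw [tsum_congr hterm, tsum_zero]
  rw [hzero, mul_zero, add_zero] at h
  exact h

end CrossingData

/-! ### The record's class at `Δ_σ = 1/8` -/

/-- **At `Δ_σ = 1/8`, for every datum of the record's class** (unitary, typed sum rule, spin 2 in `{2} ∪ [3,∞)`, scalars in
`{x} ∪ [2,∞)` with `w ≤ x`, hence all labels `≥ 0.99` by `twoSided_2d_kernel099`): `((1-y)²)^{1/8} · G(y,y) → 1` as `y → 1⁻` and
`G(y,y) → 1` as `y → 0⁺` — both corners of the diagonal are the bare identity. CONTROL-ONLY; no certificate or number of the record is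
touched. [folklore] -/
theorem record_fourPoint_corners (w : ℝ) (D : CrossingData) (hU : D.IsUnitary) (hC : D.SatisfiesCrossing (1 / 8))
    (hT : D.SpinTwoIn ({2} ∪ Ici (2 + 1))) (x : ℝ) (hwx : w ≤ x) (hS : D.ScalarsIn ({x} ∪ Ici 2)) :
    Tendsto (fun y : ℝ => ((1 - y) * (1 - y)) ^ (1 / 8 : ℝ) * D.fourPoint y y) (𝓝[<] 1) (𝓝 1) ∧
      Tendsto (fun y : ℝ => D.fourPoint y y) (𝓝[>] 0) (𝓝 1) := by
  have hx : (99 / 100 : ℝ) < x := ((twoSided_2d_kernel099 w) D hU hC hT x hwx hS).1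
  have hτ : ∀ i, (99 / 100 : ℝ) ≤ D.Δ i := fun i =>
    le_trans (le_min (le_min hx.le (by norm_num)) (by norm_num)) (CrossingData.lowerBound_of_location hU hS i)
  have hpos : ∀ i, D.p i ≠ 0 → 0 < D.Δ i := fun i _ => lt_of_lt_of_le (by norm_num) (hτ i)
  exact ⟨CrossingData.tendsto_fourPoint_corner_of_pos hU hC (by norm_num) hpos,
    CrossingData.tendsto_fourPoint_origin_of_pos hU (CrossingData.opeConvergent_free hU hC (by norm_num)) hpos⟩

end Summit.CriticalPhenomena.Ising3D.Control2D
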